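import Summits.BirchSwinnertonDyer.BirchSwinnertonDyer.Theorems.ManinLocalTwoThreeDyadicTwistFamiliesFactFree
import Summits.BirchSwinnertonDyer.BirchSwinnertonDyer.Theorems.ManinLocalTwoThreeSameLevelTwistTransport
import Literature.NumberTheory.EllipticCurves.IsogenyQuadraticTwistProofs
import Literature.NumberTheory.EllipticCurves.IsogenyDualInseparableProofs
import Literature.NumberTheory.EllipticCurves.BSDSelmerCMPConverseMaximalOrderProofs
import Literature.NumberTheory.EllipticCurves.ManinConstantQuadraticTwistLimbProofs
import Literature.NumberTheory.EllipticCurves.ManinConstantClassCertificateTwist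
import Literature.NumberTheory.EllipticCurves.LFunctionPrimeCoeffMultiplicative
import Literature.NumberTheory.LFunctions.PrimitiveQuadraticCharacterGaussSum
import HarnessLib

/-!
# THE TWIST GROUPOID ENTERS THE ADDITIVE LOCUS: `|c| = 1` propagates FACT-FREE along the dyadic twists of a `2`-ADDITIVE root and
# the aligned `q*`-twists of a `q`-ADDITIVE root (cell bsd-f2-manin, desc g45 MEMO-desc §70, TURNKEY T-desc-57; landed by p1 gen 25)

Source `HOME/desc/g45/Sketch-desc-g45.lean` (sha16 ffb2648f6e007c8a, farm rc 0) with its verbatim copies of desc g43/g44 REPLACED by imports of the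
landed `…TwistFamiliesFactFree` / `…DyadicTwistFamiliesFactFree` (T-desc-55/56).  All inputs PROVED in the tree (NO named fact; the root datum is
GIVEN, additivity is a displayed hypothesis): §0 `not_good_and_not_mult_of_isIsogenous` (additivity inherited along a `ℚ`-isogeny, fact-free);
THEOREM 70.A `abs_maninConstant_eq_one_of_negOneTwist_additive` (`χ₋₄`, ADDITIVE root, no alignment clause — Connell–Pal; p2's engine
`maninLocalTwoThree_maninConstant_dvd_mul_of_additiveTwist_of_char` with `r = 1`); 70.B `…_of_twoTwist_additive_aligned` (`χ_{±8}`, aligned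
`Δ(C) = d⁶Δ(A)`, `2⁶ ∣ N`); 70.C `…_of_oddTwist_aligned` (`χ_{q*}`, `q` odd, root arbitrary at `q`; `maninLocalTwoThree_maninConstant_dvd_of_twist_pStar_aligned`);
typed objects E-desc-230/231/232 (`NegOneTwistAdditiveLevelManinOne`, `TwoTwistAlignedAdditiveLevelManinOne`, `OddTwistAlignedLevelManinOne`), each
implied by `LevelManinOne`; THEOREM 70.D families (root `63`; the eleven `4 ∣ M` complete levels under 70.A/B — e.g. BOTH classes of conductor
`80`, both of `112`, `144a/b`, `176`, `208`; the six `9 ∣ M` levels under 70.C at `q = 3`); §4 the C2 ∧ C3 shapes on these classes, independent of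
any `η`-pinning of the target level.  HONEST SCOPE: per-class statements; nothing here proves C2, C3, Manin's conjecture or BSD.  Census (desc
g45, BC5): 1853 legal rows / 1307 Cremona classes N < 5·10⁵, falsifier 0/1853.
[cite: Stevens1989, Lemma (5.2) p. 96, Lemma (5.4) p. 97, (5.6)–(5.7) p. 98] [cite: Pal2012, Prop. 2.4 (Connell), Lemma 3.1]
[cite: Connell1999, §5.7.3] [cite: Shimura1971, Prop. 3.64] [cite: EdixhovenManin1991, Prop. 2] [cite: SilvermanAEC2009, Cor. VII.7.2, §C.16]
-/

set_option autoImplicit false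
-- the summit-side namespace `Summit.BirchSwinnertonDyer.BirchSwinnertonDyer.…` is the tree's (summit = sub-problem)
set_option linter.dupNamespace false

noncomputable section

open scoped Classical NumberField MatrixGroups ModularForm

namespace Summit.BirchSwinnertonDyer.BirchSwinnertonDyer.Theorems.ManinLocalTwoThree.AdditiveTwistFamilies

open WeierstrassCurve CongruenceSubgroup IsDedekindDomain IsDedekindDomain.HeightOneSpectrum Rat.HeightOneSpectrum
  Literature.NumberTheory.Automorphic Literature.NumberTheory.EllipticCurves Literature.NumberTheory.EllipticCurves.ModularForms
  Literature.NumberTheory.LFunctions.PrimitiveQuadratic Summit.BirchSwinnertonDyer.BirchSwinnertonDyer.Theorems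
  Summit.BirchSwinnertonDyer.BirchSwinnertonDyer.Theorems.ManinLocalTwoThree Summit.BirchSwinnertonDyer.Rank1Residual.ManinAdditive
  Summit.BirchSwinnertonDyer.BirchSwinnertonDyer.Theorems.ManinLocalTwoThree.TwistFamilies
  Summit.BirchSwinnertonDyer.BirchSwinnertonDyer.Theorems.ManinLocalTwoThree.DyadicTwistFamilies

/-- **Additive reduction at `p` is inherited along a `ℚ`-isogeny, FACT-FREE.**  If `V ∼ V'` and `V'` is
neither good nor multiplicative at `p`, then so is `V`: good reduction is an isogeny invariant
(`IsIsogenous.hasGoodReductionAtPrime_iff`, Silverman VII.7.2), and if `V` were multiplicative at `p` then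
`a_p(V) = ±1 ≠ 0` (Silverman §C.16) while `a_p(V') = 0` and `L(V, s) = L(V', s)`
(`LFunction_eq_of_isIsogenous_holds`).  (The tree reads additivity off `p² ∣ N` through the conditional
`conductorNorm_eq_of_isIsogenous_of_modularity`; this replaces it.) [cite: SilvermanAEC2009, Cor. VII.7.2, §C.16] -/
theorem not_good_and_not_mult_of_isIsogenous {V V' : WeierstrassCurve ℚ} [V.IsElliptic] [V'.IsElliptic]
    (h : IsIsogenous V V') (p : ℕ) [Fact p.Prime]
    (hadd' : ¬ V'.HasGoodReductionAtPrime p ∧ ¬ V'.HasMultiplicativeReductionAtPrime p) :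
    ¬ V.HasGoodReductionAtPrime p ∧ ¬ V.HasMultiplicativeReductionAtPrime p := by
  refine ⟨fun hg ↦ hadd'.1 ((h.hasGoodReductionAtPrime_iff p).mp hg), fun hm ↦ ?_⟩
  have h0 : V'.LFunction p = 0 :=
    V'.LFunction_apply_eq_zero_of_not_good_of_not_mult p hadd'.1 hadd'.2 (dvd_refl p)
  have hL : V.LFunction = V'.LFunction := LFunction_eq_of_isIsogenous_holds _ _ h
  have hV : V.LFunction p = 0 := by rw [hL, h0]
  by_cases hs : V.HasSplitMultiplicativeReductionAtPrime p
  · rw [V.LFunction_apply_prime_of_hasSplitMultiplicativeReductionAtPrime p hs] at hV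
    exact one_ne_zero hV
  · rw [V.LFunction_apply_prime_of_hasMultiplicativeReductionAtPrime_of_not_split p hm hs] at hV
    norm_num at hV

/-- **THEOREM 70.A — `χ₋₄`-propagation of `|c| = 1` from a `2`-ADDITIVE root, NO NAMED FACT.**  `A`
globally minimal, ADDITIVE at `2`, with an `X₀(M)`-datum `D_A`, `|c(D_A)| = 1`, `4 ∣ M`; `W'` globally
minimal, ADDITIVE at `2`, isogenous over `ℚ` to `A ⊗ ℚ(√−1)`, with a lattice-optimal `X₀(N)`-datum `D'`,
`M ∣ N`, `2⁴ ∣ N`.  Then `|c(D')| = 1`.  No alignment clause: for the minimal model `C` of `A ⊗ (−1)`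
(additive at `2` because `W' ∼ C` is, §0) Connell–Pal gives `Δ(C) = Δ(A)`, so `r = 1` in p2's engine.
[cite: Stevens1989, Lemma (5.4) p. 97] [cite: Pal2012, Prop. 2.4 (Connell), Lemma 3.1] [cite: Connell1999, §5.7.3] -/
theorem abs_maninConstant_eq_one_of_negOneTwist_additive
    {A : WeierstrassCurve ℚ} [A.IsElliptic] [A.IsGloballyMinimal] {M : ℕ} [NeZero M]
    (DA : ModularParametrizationData A M) (hDA : |DA.maninConstant| = 1) (h4M : 4 ∣ M)
    (haddA : ¬ A.HasGoodReductionAtPrime 2 ∧ ¬ A.HasMultiplicativeReductionAtPrime 2)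
    {W' : WeierstrassCurve ℚ} [W'.IsElliptic] [W'.IsGloballyMinimal] {N : ℕ} [NeZero N]
    (D' : ModularParametrizationData W' N) (hMN : M ∣ N) (h16N : 2 ^ 4 ∣ N)
    (htw : IsIsogenous W' (A.quadraticTwist ((-1 : ℤ) : ℚ)))
    (hadd' : ¬ W'.HasGoodReductionAtPrime 2 ∧ ¬ W'.HasMultiplicativeReductionAtPrime 2)
    (hopt' : ∀ z ∈ D'.L.lattice, ∃ w ∈ periodLattice D'.f, z = D'.c * w) :
    |D'.maninConstant| = 1 := by
  haveI : Fact (Nat.Prime 2) := ⟨Nat.prime_two⟩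
  have hd0 : ((-1 : ℤ) : ℚ) ≠ 0 := by norm_num
  haveI : (A.quadraticTwist ((-1 : ℤ) : ℚ)).IsElliptic := A.isElliptic_quadraticTwist hd0
  -- a minimal model `C` of `A ⊗ (−1)`; it is isogenous to `W'`, hence ADDITIVE at `2` (fact-free, §0)
  obtain ⟨vC, hvC⟩ := hasGlobalMinimalModel_rat_holds (A.quadraticTwist ((-1 : ℤ) : ℚ))
  haveI := hvC
  have hCW : IsIsogenous (vC • A.quadraticTwist ((-1 : ℤ) : ℚ)) W' :=
    (isIsogenous_of_smul (A.quadraticTwist ((-1 : ℤ) : ℚ)) vC).trans' (IsIsogenous.symm_of_isElliptic htw)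
  have haddC : ¬ (vC • A.quadraticTwist ((-1 : ℤ) : ℚ)).HasGoodReductionAtPrime 2 ∧
      ¬ (vC • A.quadraticTwist ((-1 : ℤ) : ℚ)).HasMultiplicativeReductionAtPrime 2 :=
    not_good_and_not_mult_of_isIsogenous hCW 2 hadd'
  have h4A : 2 ^ 2 ∣ A.conductorNorm ℤ := sq_dvd_conductorNorm_of_not_good_of_not_mult haddA
  have h4C : 2 ^ 2 ∣ (vC • A.quadraticTwist ((-1 : ℤ) : ℚ)).conductorNorm ℤ :=
    sq_dvd_conductorNorm_of_not_good_of_not_mult haddC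
  -- Connell–Pal: `Δ(C) = Δ(A)`, i.e. `r = 1`
  have hΔC : (vC • A.quadraticTwist ((-1 : ℤ) : ℚ)).Δ = A.Δ :=
    connellPal_Δ_eq_of_negOne_twist_of_four_dvd_conductor_holds A _ vC h4A h4C rfl
  have hΔ : ((1 : ℤ) : ℚ) ^ 12 * (vC • A.quadraticTwist ((-1 : ℤ) : ℚ)).Δ =
      (((-1 : ℤ) : ℚ)) ^ 6 * A.Δ := by
    rw [hΔC]; norm_num
  -- p2's additive → additive engine with `χ₄`, `r = 1`
  have hdvd : D'.c ∣ 1 * DA.c :=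
    maninLocalTwoThree_maninConstant_dvd_mul_of_additiveTwist_of_char D' hopt' DA (d := -1)
      (by norm_num) isQuadratic_χ₄_ringHomComp isPrimitive_χ₄_ringHomComp
      (by rw [gaussSum_χ₄_ringHomComp_sq]; norm_num)
      (fun hhalf x ↦ ⟨1, 3, 0, sum_χ₄_modularSymbol_of_half DA.f hhalf x⟩)
      (fun n hn ↦ by
        rw [show ((-1 : ℤ) : ℚ) = -1 by norm_num, A.LFunction_quadraticTwist_neg_one_apply_of_odd hn,
          Int.cast_mul, χ₄_ringHomComp_apply_natCast])
      (fun n hn ↦ by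
        rw [χ₄_ringHomComp_apply_natCast, ZMod.χ₄_nat_eq_if_mod_four, if_pos (Nat.mod_eq_zero_of_dvd hn)]
        simp)
      htw vC rfl hΔ hMN (by simpa using h16N) h4M haddA hadd'
  rw [one_mul] at hdvd
  exact abs_eq_one_of_dvd_of_abs_eq_one hdvd hDA

/-- **THEOREM 70.B — ALIGNED `χ_{±8}`-propagation of `|c| = 1` from a `2`-ADDITIVE root, NO NAMED FACT.**
`A` globally minimal, additive at `2`, `X₀(M)`-datum `D_A` with `|c(D_A)| = 1`, `4 ∣ M`; `d = ±2`; a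
globally minimal `C = u • (A ⊗ d)` with the ALIGNMENT clause `Δ(C) = d⁶ Δ(A)`; `W'` globally minimal,
additive at `2`, `W' ∼ A ⊗ ℚ(√d)`, lattice-optimal `X₀(N)`-datum `D'`, `M ∣ N`, `2⁶ ∣ N`.  Then `|c(D')| = 1`
(p2's engine with `χ₈ / χ₈′`, `r = 1`). [cite: Stevens1989, Lemma (5.4) p. 97] [cite: Pal2012, Prop. 2.4 (clause d ≡ 2 mod 4), Lemma 3.1] -/
theorem abs_maninConstant_eq_one_of_twoTwist_additive_aligned {d : ℤ} (hd : d = 2 ∨ d = -2)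
    {A : WeierstrassCurve ℚ} [A.IsElliptic] [A.IsGloballyMinimal] {M : ℕ} [NeZero M]
    (DA : ModularParametrizationData A M) (hDA : |DA.maninConstant| = 1) (h4M : 4 ∣ M)
    (haddA : ¬ A.HasGoodReductionAtPrime 2 ∧ ¬ A.HasMultiplicativeReductionAtPrime 2)
    {C : WeierstrassCurve ℚ} [C.IsElliptic] [C.IsGloballyMinimal] (u : VariableChange ℚ)
    (hu : u • A.quadraticTwist (d : ℚ) = C) (hΔ : C.Δ = (d : ℚ) ^ 6 * A.Δ)
    {W' : WeierstrassCurve ℚ} [W'.IsElliptic] [W'.IsGloballyMinimal] {N : ℕ} [NeZero N]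
    (D' : ModularParametrizationData W' N) (hMN : M ∣ N) (h64N : 2 ^ 6 ∣ N)
    (htw : IsIsogenous W' (A.quadraticTwist (d : ℚ)))
    (hadd' : ¬ W'.HasGoodReductionAtPrime 2 ∧ ¬ W'.HasMultiplicativeReductionAtPrime 2)
    (hopt' : ∀ z ∈ D'.L.lattice, ∃ w ∈ periodLattice D'.f, z = D'.c * w) :
    |D'.maninConstant| = 1 := by
  haveI : Fact (Nat.Prime 2) := ⟨Nat.prime_two⟩
  have hdZ : d ≠ 0 := by rcases hd with rfl | rfl <;> norm_num
  have hΔ' : ((1 : ℤ) : ℚ) ^ 12 * C.Δ = (d : ℚ) ^ 6 * A.Δ := by rw [hΔ]; norm_num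
  have hmN : 8 ^ 2 ∣ N := by simpa using h64N
  have hdvd : D'.c ∣ 1 * DA.c := by
    rcases hd with rfl | rfl
    · exact maninLocalTwoThree_maninConstant_dvd_mul_of_additiveTwist_of_char D' hopt' DA hdZ
        isQuadratic_χ₈_ringHomComp isPrimitive_χ₈_ringHomComp
        (by rw [gaussSum_χ₈_ringHomComp_sq]; norm_num)
        (fun hhalf x ↦ ⟨1, 3, -1, sum_χ₈_modularSymbol_of_half DA.f hhalf x⟩)
        (fun n hn ↦ by
          rw [show ((2 : ℤ) : ℚ) = 2 by norm_num, A.LFunction_quadraticTwist_two_apply_of_odd hn,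
            Int.cast_mul, χ₈_ringHomComp_apply_natCast])
        (fun n hn ↦ by
          rw [χ₈_ringHomComp_apply_natCast, ZMod.χ₈_nat_eq_if_mod_eight,
            if_pos (Nat.mod_eq_zero_of_dvd hn)]
          simp)
        htw u hu hΔ' hMN hmN h4M haddA hadd'
    · exact maninLocalTwoThree_maninConstant_dvd_mul_of_additiveTwist_of_char D' hopt' DA hdZ
        isQuadratic_χ₈'_ringHomComp isPrimitive_χ₈'_ringHomComp
        (by rw [gaussSum_χ₈'_ringHomComp_sq]; norm_num)
        (fun hhalf x ↦ ⟨1, 3, 1, sum_χ₈'_modularSymbol_of_half DA.f hhalf x⟩)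
        (fun n hn ↦ by
          rw [show ((-2 : ℤ) : ℚ) = -2 by norm_num, A.LFunction_quadraticTwist_neg_two_apply_of_odd hn,
            Int.cast_mul, χ₈'_ringHomComp_apply_natCast])
        (fun n hn ↦ by
          rw [χ₈'_ringHomComp_apply_natCast, ZMod.χ₈'_nat_eq_if_mod_eight,
            if_pos (Nat.mod_eq_zero_of_dvd hn)]
          simp)
        htw u hu hΔ' hMN hmN h4M haddA hadd'
  rw [one_mul] at hdvd
  exact abs_eq_one_of_dvd_of_abs_eq_one hdvd hDA

/-- **THEOREM 70.C — ALIGNED `χ_{q*}`-propagation of `|c| = 1`, `q` odd, ROOT ARBITRARY at `q`, NO NAMED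
FACT.**  `A` elliptic with an `X₀(M)`-datum `D_A`, `|c(D_A)| = 1`; a globally minimal `C = u • (A ⊗ q*)`
with `Δ(C) = (q*)⁶ Δ(A)` (ALIGNED); `W'` globally minimal, ADDITIVE at `q`, `W' ∼ A ⊗ ℚ(√q*)`, with a
lattice-optimal `X₀(N)`-datum `D'`, `M ∣ N`, `q² ∣ N`.  Then `|c(D')| = 1` (p2/p3's Stevens-(1.4)-free
`maninLocalTwoThree_maninConstant_dvd_of_twist_pStar_aligned`: `c(D') ∣ c(D_A)`).
[cite: Stevens1989, Lemmas (5.2), (5.4)] [cite: Pal2012, Lemma 3.1] -/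
theorem abs_maninConstant_eq_one_of_oddTwist_aligned {q : ℕ} [Fact q.Prime] (hq2 : q ≠ 2)
    {A : WeierstrassCurve ℚ} [A.IsElliptic] {M : ℕ} [NeZero M]
    (DA : ModularParametrizationData A M) (hDA : |DA.maninConstant| = 1)
    {C : WeierstrassCurve ℚ} [C.IsElliptic] [C.IsGloballyMinimal] (u : VariableChange ℚ)
    (hu : u • A.quadraticTwist (((-1 : ℤ) ^ (q / 2) * q : ℤ) : ℚ) = C)
    (hΔ : C.Δ = ((((-1 : ℤ) ^ (q / 2) * q : ℤ)) : ℚ) ^ 6 * A.Δ)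
    {W' : WeierstrassCurve ℚ} [W'.IsElliptic] [W'.IsGloballyMinimal] {N : ℕ} [NeZero N]
    (D' : ModularParametrizationData W' N) (hMN : M ∣ N) (hqN : q ^ 2 ∣ N)
    (htw : IsIsogenous W' (A.quadraticTwist (((-1 : ℤ) ^ (q / 2) * q : ℤ) : ℚ)))
    (hadd' : ¬ W'.HasGoodReductionAtPrime q ∧ ¬ W'.HasMultiplicativeReductionAtPrime q)
    (hopt' : ∀ z ∈ D'.L.lattice, ∃ w ∈ periodLattice D'.f, z = D'.c * w) :
    |D'.maninConstant| = 1 := by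
  have hqP : q.Prime := Fact.out
  have hd0 : ((((-1 : ℤ) ^ (q / 2) * q : ℤ)) : ℚ) ≠ 0 := by
    push_cast
    exact mul_ne_zero (pow_ne_zero _ (by norm_num)) (by exact_mod_cast hqP.ne_zero)
  haveI : (A.quadraticTwist (((-1 : ℤ) ^ (q / 2) * q : ℤ) : ℚ)).IsElliptic := A.isElliptic_quadraticTwist hd0
  have hCW : IsIsogenous C W' :=
    (isIsogenous_of_smul_eq' hu).trans' (IsIsogenous.symm_of_isElliptic htw)
  exact abs_eq_one_of_dvd_of_abs_eq_one
    (maninLocalTwoThree_maninConstant_dvd_of_twist_pStar_aligned hq2 D' hopt' DA hMN hqN hadd' u hu hCW hΔ)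
    hDA

/-- **E-desc-230 `NegOneTwistAdditiveLevelManinOne M`** — `|c| = 1` ON THE `χ₋₄`-TWIST IMAGE OF LEVEL `M`
FROM A `2`-ADDITIVE ROOT: for every lattice-optimal `X₀(M)`-datum `D` on a globally minimal curve `A`
ADDITIVE at `2`, and every globally minimal `W'` ADDITIVE at `2`, isogenous to `A ⊗ ℚ(√−1)`, with a
lattice-optimal `X₀(N)`-datum `D'` (`M ∣ N`, `2⁴ ∣ N`): `|c(D')| = 1`.  NO ALIGNMENT CLAUSE (Connell–Pal).
THEOREM for every complete `M` with `4 ∣ M` (§3). [cite: Stevens1989, Lemma (5.4)] [cite: Pal2012, Prop. 2.4, Lemma 3.1] -/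
def NegOneTwistAdditiveLevelManinOne (M : ℕ) [NeZero M] : Prop :=
  ∀ (A : WeierstrassCurve ℚ) [A.IsElliptic] [A.IsGloballyMinimal] (D : ModularParametrizationData A M),
    (∀ z ∈ D.L.lattice, ∃ w ∈ periodLattice D.f, z = D.c * w) →
    (¬ A.HasGoodReductionAtPrime 2 ∧ ¬ A.HasMultiplicativeReductionAtPrime 2) →
  ∀ (W' : WeierstrassCurve ℚ) [W'.IsElliptic] [W'.IsGloballyMinimal] (N : ℕ) [NeZero N]
    (D' : ModularParametrizationData W' N), M ∣ N → 2 ^ 4 ∣ N →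
    IsIsogenous W' (A.quadraticTwist ((-1 : ℤ) : ℚ)) →
    (¬ W'.HasGoodReductionAtPrime 2 ∧ ¬ W'.HasMultiplicativeReductionAtPrime 2) →
    (∀ z ∈ D'.L.lattice, ∃ w ∈ periodLattice D'.f, z = D'.c * w) → |D'.maninConstant| = 1

/-- **E-desc-231 `TwoTwistAlignedAdditiveLevelManinOne M d`** (`d = ±2`) — `|c| = 1` ON THE ALIGNED
`χ_{±8}`-TWIST IMAGE OF LEVEL `M` FROM A `2`-ADDITIVE ROOT: as E-desc-230 with `W' ∼ A ⊗ ℚ(√d)`, `2⁶ ∣ N`,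
and the displayed alignment clause `Δ(C) = d⁶ Δ(A)` for a globally minimal `C = u • (A ⊗ d)`.
THEOREM for every complete `M` with `4 ∣ M` (§3). [cite: Stevens1989, Lemma (5.4)] [cite: Pal2012, Prop. 2.4, Lemma 3.1] -/
def TwoTwistAlignedAdditiveLevelManinOne (M : ℕ) [NeZero M] (d : ℤ) : Prop :=
  ∀ (A : WeierstrassCurve ℚ) [A.IsElliptic] [A.IsGloballyMinimal] (D : ModularParametrizationData A M),
    (∀ z ∈ D.L.lattice, ∃ w ∈ periodLattice D.f, z = D.c * w) →
    (¬ A.HasGoodReductionAtPrime 2 ∧ ¬ A.HasMultiplicativeReductionAtPrime 2) →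
  ∀ (C : WeierstrassCurve ℚ) [C.IsElliptic] [C.IsGloballyMinimal] (u : VariableChange ℚ),
    u • A.quadraticTwist (d : ℚ) = C → C.Δ = (d : ℚ) ^ 6 * A.Δ →
  ∀ (W' : WeierstrassCurve ℚ) [W'.IsElliptic] [W'.IsGloballyMinimal] (N : ℕ) [NeZero N]
    (D' : ModularParametrizationData W' N), M ∣ N → 2 ^ 6 ∣ N →
    IsIsogenous W' (A.quadraticTwist (d : ℚ)) →
    (¬ W'.HasGoodReductionAtPrime 2 ∧ ¬ W'.HasMultiplicativeReductionAtPrime 2) →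
    (∀ z ∈ D'.L.lattice, ∃ w ∈ periodLattice D'.f, z = D'.c * w) → |D'.maninConstant| = 1

/-- **E-desc-232 `OddTwistAlignedLevelManinOne M q`** (`q` odd prime) — `|c| = 1` ON THE ALIGNED
`χ_{q*}`-TWIST IMAGE OF LEVEL `M`, ROOT ARBITRARY AT `q`: for every lattice-optimal `X₀(M)`-datum `D` on a
globally minimal `A`, every globally minimal `C = u • (A ⊗ q*)` with `Δ(C) = (q*)⁶ Δ(A)`, and every
globally minimal `W'` ADDITIVE at `q`, `W' ∼ A ⊗ ℚ(√q*)`, with a lattice-optimal `X₀(N)`-datum `D'`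
(`M ∣ N`, `q² ∣ N`): `|c(D')| = 1`.  THEOREM for every complete `M` (§3). [cite: Stevens1989, Lemma (5.2), (5.4)] [cite: Pal2012, Lemma 3.1] -/
def OddTwistAlignedLevelManinOne (M q : ℕ) [NeZero M] [Fact q.Prime] : Prop :=
  ∀ (A : WeierstrassCurve ℚ) [A.IsElliptic] [A.IsGloballyMinimal] (D : ModularParametrizationData A M),
    (∀ z ∈ D.L.lattice, ∃ w ∈ periodLattice D.f, z = D.c * w) →
  ∀ (C : WeierstrassCurve ℚ) [C.IsElliptic] [C.IsGloballyMinimal] (u : VariableChange ℚ),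
    u • A.quadraticTwist (((-1 : ℤ) ^ (q / 2) * q : ℤ) : ℚ) = C →
    C.Δ = ((((-1 : ℤ) ^ (q / 2) * q : ℤ)) : ℚ) ^ 6 * A.Δ →
  ∀ (W' : WeierstrassCurve ℚ) [W'.IsElliptic] [W'.IsGloballyMinimal] (N : ℕ) [NeZero N]
    (D' : ModularParametrizationData W' N), M ∣ N → q ^ 2 ∣ N →
    IsIsogenous W' (A.quadraticTwist (((-1 : ℤ) ^ (q / 2) * q : ℤ) : ℚ)) →
    (¬ W'.HasGoodReductionAtPrime q ∧ ¬ W'.HasMultiplicativeReductionAtPrime q) →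
    (∀ z ∈ D'.L.lattice, ∃ w ∈ periodLattice D'.f, z = D'.c * w) → |D'.maninConstant| = 1

/-- **LevelManinOne M ∧ 4 ∣ M ⇒ NegOneTwistAdditiveLevelManinOne M** (THEOREM 70.A, universally). -/
theorem negOneTwistAdditiveLevelManinOne_of_levelManinOne {M : ℕ} [NeZero M] (hM : LevelManinOne M)
    (h4M : 4 ∣ M) : NegOneTwistAdditiveLevelManinOne M := by
  intro A _ _ D hopt haddA W' _ _ N _ D' hMN h16N htw hadd' hopt'
  exact abs_maninConstant_eq_one_of_negOneTwist_additive D (hM A D hopt) h4M haddA D' hMN h16N htw hadd'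
    hopt'

/-- **LevelManinOne M ∧ 4 ∣ M ⇒ TwoTwistAlignedAdditiveLevelManinOne M d, `d = ±2`** (THEOREM 70.B, universally). -/
theorem twoTwistAlignedAdditiveLevelManinOne_of_levelManinOne {M : ℕ} [NeZero M] (hM : LevelManinOne M)
    (h4M : 4 ∣ M) {d : ℤ} (hd : d = 2 ∨ d = -2) : TwoTwistAlignedAdditiveLevelManinOne M d := by
  intro A _ _ D hopt haddA C _ _ u hu hΔ W' _ _ N _ D' hMN h64N htw hadd' hopt'
  exact abs_maninConstant_eq_one_of_twoTwist_additive_aligned hd D (hM A D hopt) h4M haddA u hu hΔ D' hMN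
    h64N htw hadd' hopt'

/-- **LevelManinOne M ⇒ OddTwistAlignedLevelManinOne M q for every odd prime `q`** (THEOREM 70.C, universally). -/
theorem oddTwistAlignedLevelManinOne_of_levelManinOne {M : ℕ} [NeZero M] (hM : LevelManinOne M)
    {q : ℕ} [Fact q.Prime] (hq2 : q ≠ 2) : OddTwistAlignedLevelManinOne M q := by
  intro A _ _ D hopt C _ _ u hu hΔ W' _ _ N _ D' hMN hqN htw hadd' hopt'
  exact abs_maninConstant_eq_one_of_oddTwist_aligned hq2 D (hM A D hopt) u hu hΔ D' hMN hqN htw hadd' hopt'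

/-- **ROOT `63` JOINS THE TWIST GROUPOID (THEOREM 70.D (i)), NO NAMED FACT**: for every odd prime `p`,
`|c| = 1` on the `χ_{p*}`-twist image of level `63` (families `63p²`, `p ∤ 21`; `p = 7`: the root is
MULTIPLICATIVE at `7`, family `441, 441·k`; `p = 3`: vacuous on `63a`, additive at `3`), and for every
`d ∈ {−1, ±2}`, `|c| = 1` on the dyadic image (`63a` is GOOD at `2`, `2 ∤ 63`: levels `1008`, `4032` and
multiples — additive at `2` AND `3`, inside BOTH crux domains). -/
theorem twist_families_sixtyThree {p : ℕ} [Fact p.Prime] (hp2 : p ≠ 2) {d : ℤ} (hd : d = -1 ∨ d = 2 ∨ d = -2) :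
    TwistLevelManinOne 63 p ∧ DyadicTwistLevelManinOne 63 d ∧ OddTwistAlignedLevelManinOne 63 p :=
  ⟨twistLevelManinOne_of_levelManinOne levelManinOne_sixtyThree hp2,
   dyadicTwistLevelManinOne_of_levelManinOne levelManinOne_sixtyThree hd,
   oddTwistAlignedLevelManinOne_of_levelManinOne levelManinOne_sixtyThree hp2⟩

/-- **THEOREM 70.D (ii) — the eleven `χ₋₄` ADDITIVE-ROOT families, NO NAMED FACT**: `|c| = 1` on the
`χ₋₄`-twist image of each complete level `M` with `4 ∣ M` (both classes of conductor `80`, both of `112`,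
`144a/b`, `176`, `208`, …, and every level `N` with `M ∣ N`, `16 ∣ N` carrying such a class). -/
theorem negOneTwistAdditive_families :
    NegOneTwistAdditiveLevelManinOne 20 ∧ NegOneTwistAdditiveLevelManinOne 24 ∧
    NegOneTwistAdditiveLevelManinOne 32 ∧ NegOneTwistAdditiveLevelManinOne 36 ∧
    NegOneTwistAdditiveLevelManinOne 40 ∧ NegOneTwistAdditiveLevelManinOne 44 ∧
    NegOneTwistAdditiveLevelManinOne 48 ∧ NegOneTwistAdditiveLevelManinOne 52 ∧
    NegOneTwistAdditiveLevelManinOne 56 ∧ NegOneTwistAdditiveLevelManinOne 64 ∧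
    NegOneTwistAdditiveLevelManinOne 72 :=
  ⟨negOneTwistAdditiveLevelManinOne_of_levelManinOne levelManinOne_twenty (by norm_num),
   negOneTwistAdditiveLevelManinOne_of_levelManinOne levelManinOne_twentyFour (by norm_num),
   negOneTwistAdditiveLevelManinOne_of_levelManinOne levelManinOne_thirtyTwo (by norm_num),
   negOneTwistAdditiveLevelManinOne_of_levelManinOne levelManinOne_thirtySix (by norm_num),
   negOneTwistAdditiveLevelManinOne_of_levelManinOne levelManinOne_forty (by norm_num),
   negOneTwistAdditiveLevelManinOne_of_levelManinOne levelManinOne_fortyFour (by norm_num),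
   negOneTwistAdditiveLevelManinOne_of_levelManinOne levelManinOne_fortyEight (by norm_num),
   negOneTwistAdditiveLevelManinOne_of_levelManinOne levelManinOne_fiftyTwo (by norm_num),
   negOneTwistAdditiveLevelManinOne_of_levelManinOne levelManinOne_fiftySix (by norm_num),
   negOneTwistAdditiveLevelManinOne_of_levelManinOne levelManinOne_sixtyFour (by norm_num),
   negOneTwistAdditiveLevelManinOne_of_levelManinOne levelManinOne_seventyTwo (by norm_num)⟩

/-- **THEOREM 70.D (ii′) — the eleven ALIGNED `χ_{±8}` ADDITIVE-ROOT families, NO NAMED FACT.** -/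
theorem twoTwistAlignedAdditive_families {d : ℤ} (hd : d = 2 ∨ d = -2) :
    TwoTwistAlignedAdditiveLevelManinOne 20 d ∧ TwoTwistAlignedAdditiveLevelManinOne 24 d ∧
    TwoTwistAlignedAdditiveLevelManinOne 32 d ∧ TwoTwistAlignedAdditiveLevelManinOne 36 d ∧
    TwoTwistAlignedAdditiveLevelManinOne 40 d ∧ TwoTwistAlignedAdditiveLevelManinOne 44 d ∧
    TwoTwistAlignedAdditiveLevelManinOne 48 d ∧ TwoTwistAlignedAdditiveLevelManinOne 52 d ∧
    TwoTwistAlignedAdditiveLevelManinOne 56 d ∧ TwoTwistAlignedAdditiveLevelManinOne 64 d ∧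
    TwoTwistAlignedAdditiveLevelManinOne 72 d :=
  ⟨twoTwistAlignedAdditiveLevelManinOne_of_levelManinOne levelManinOne_twenty (by norm_num) hd,
   twoTwistAlignedAdditiveLevelManinOne_of_levelManinOne levelManinOne_twentyFour (by norm_num) hd,
   twoTwistAlignedAdditiveLevelManinOne_of_levelManinOne levelManinOne_thirtyTwo (by norm_num) hd,
   twoTwistAlignedAdditiveLevelManinOne_of_levelManinOne levelManinOne_thirtySix (by norm_num) hd,
   twoTwistAlignedAdditiveLevelManinOne_of_levelManinOne levelManinOne_forty (by norm_num) hd,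
   twoTwistAlignedAdditiveLevelManinOne_of_levelManinOne levelManinOne_fortyFour (by norm_num) hd,
   twoTwistAlignedAdditiveLevelManinOne_of_levelManinOne levelManinOne_fortyEight (by norm_num) hd,
   twoTwistAlignedAdditiveLevelManinOne_of_levelManinOne levelManinOne_fiftyTwo (by norm_num) hd,
   twoTwistAlignedAdditiveLevelManinOne_of_levelManinOne levelManinOne_fiftySix (by norm_num) hd,
   twoTwistAlignedAdditiveLevelManinOne_of_levelManinOne levelManinOne_sixtyFour (by norm_num) hd,
   twoTwistAlignedAdditiveLevelManinOne_of_levelManinOne levelManinOne_seventyTwo (by norm_num) hd⟩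

/-- **THEOREM 70.D (iii) — the six ALIGNED `χ₋₃` families of the `9 ∣ M` levels (root arbitrary at `3`),
NO NAMED FACT** (for a root semistable at `q` every `q*`-twist is aligned; `q = 3` shown, any odd `q` holds). -/
theorem oddTwistAligned_families_three :
    haveI : Fact (Nat.Prime 3) := ⟨Nat.prime_three⟩
    OddTwistAlignedLevelManinOne 27 3 ∧ OddTwistAlignedLevelManinOne 36 3 ∧
    OddTwistAlignedLevelManinOne 45 3 ∧ OddTwistAlignedLevelManinOne 54 3 ∧
    OddTwistAlignedLevelManinOne 63 3 ∧ OddTwistAlignedLevelManinOne 72 3 :=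
  haveI : Fact (Nat.Prime 3) := ⟨Nat.prime_three⟩
  ⟨oddTwistAlignedLevelManinOne_of_levelManinOne levelManinOne_twentySeven (by norm_num),
   oddTwistAlignedLevelManinOne_of_levelManinOne levelManinOne_thirtySix (by norm_num),
   oddTwistAlignedLevelManinOne_of_levelManinOne levelManinOne_fortyFive (by norm_num),
   oddTwistAlignedLevelManinOne_of_levelManinOne levelManinOne_fiftyFour (by norm_num),
   oddTwistAlignedLevelManinOne_of_levelManinOne levelManinOne_sixtyThree (by norm_num),
   oddTwistAlignedLevelManinOne_of_levelManinOne levelManinOne_seventyTwo (by norm_num)⟩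

/-! ## The C2 ∧ C3 shapes on the new families -/
/-- **C2-shape (`2 ∤ c`) AND C3-shape (`3 ∤ c`) on a `χ₋₄` additive-root image**: the conclusions of BOTH
cruxes `ManinOddAtFour` (`4 ∣ N`) and `ManinPrimeToThreeAtNine` with NONE of their printed hypotheses. -/
theorem shapes_of_negOneTwistAdditiveLevelManinOne {M : ℕ} [NeZero M] (h : NegOneTwistAdditiveLevelManinOne M)
    (A : WeierstrassCurve ℚ) [A.IsElliptic] [A.IsGloballyMinimal] (D : ModularParametrizationData A M)
    (hopt : ∀ z ∈ D.L.lattice, ∃ w ∈ periodLattice D.f, z = D.c * w)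
    (haddA : ¬ A.HasGoodReductionAtPrime 2 ∧ ¬ A.HasMultiplicativeReductionAtPrime 2)
    (W' : WeierstrassCurve ℚ) [W'.IsElliptic] [W'.IsGloballyMinimal] (N : ℕ) [NeZero N]
    (D' : ModularParametrizationData W' N) (hMN : M ∣ N) (h16N : 2 ^ 4 ∣ N)
    (htw : IsIsogenous W' (A.quadraticTwist ((-1 : ℤ) : ℚ)))
    (hadd' : ¬ W'.HasGoodReductionAtPrime 2 ∧ ¬ W'.HasMultiplicativeReductionAtPrime 2)
    (hopt' : ∀ z ∈ D'.L.lattice, ∃ w ∈ periodLattice D'.f, z = D'.c * w) :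
    |D'.maninConstant| = 1 ∧ ¬ (2 : ℤ) ∣ D'.maninConstant ∧ ¬ (3 : ℤ) ∣ D'.maninConstant :=
  have h1 := h A D hopt haddA W' N D' hMN h16N htw hadd' hopt'
  ⟨h1, not_dvd_of_abs_eq_one h1 (by decide), not_dvd_of_abs_eq_one h1 (by decide)⟩

/-- **Level `80 = 2⁴·5`, BOTH classes, from the `2`-additive roots `20a` and `40a`** (`80 = 20a ⊗ χ₋₄`'s
and `40a ⊗ χ₋₄`'s conductor): for every globally minimal `W'` additive at `2`, isogenous to the `χ₋₄`-twist
of a `2`-additive carrier `A` of a lattice-optimal `X₀(20)`- or `X₀(40)`-datum, every lattice-optimal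
`X₀(80)`-datum `D'` of `W'` has `|c(D')| = 1 ∧ 2 ∤ c(D')` — C2 `ManinOddAtFour` on these classes, FACT-FREE,
independently of the `η`-basis pinning of level `80`. -/
theorem maninOddAtFour_shape_eighty_of_root_twenty_or_forty
    {M : ℕ} [NeZero M] (hM : M = 20 ∨ M = 40)
    (A : WeierstrassCurve ℚ) [A.IsElliptic] [A.IsGloballyMinimal] (D : ModularParametrizationData A M)
    (hopt : ∀ z ∈ D.L.lattice, ∃ w ∈ periodLattice D.f, z = D.c * w)
    (haddA : ¬ A.HasGoodReductionAtPrime 2 ∧ ¬ A.HasMultiplicativeReductionAtPrime 2)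
    (W' : WeierstrassCurve ℚ) [W'.IsElliptic] [W'.IsGloballyMinimal] [NeZero (80 : ℕ)]
    (D' : ModularParametrizationData W' 80)
    (htw : IsIsogenous W' (A.quadraticTwist ((-1 : ℤ) : ℚ)))
    (hadd' : ¬ W'.HasGoodReductionAtPrime 2 ∧ ¬ W'.HasMultiplicativeReductionAtPrime 2)
    (hopt' : ∀ z ∈ D'.L.lattice, ∃ w ∈ periodLattice D'.f, z = D'.c * w) :
    |D'.maninConstant| = 1 ∧ ¬ (2 : ℤ) ∣ D'.maninConstant := by
  rcases hM with rfl | rfl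
  · have h := shapes_of_negOneTwistAdditiveLevelManinOne negOneTwistAdditive_families.1 A D hopt haddA W' 80
      D' (by norm_num) (by norm_num) htw hadd' hopt'
    exact ⟨h.1, h.2.1⟩
  · have h := shapes_of_negOneTwistAdditiveLevelManinOne negOneTwistAdditive_families.2.2.2.2.1 A D hopt
      haddA W' 80 D' (by norm_num) (by norm_num) htw hadd' hopt'
    exact ⟨h.1, h.2.1⟩

/-- **Level `144 = 2⁴·3²` from the roots `36a` / `72a` (additive at BOTH `2` and `3`; `4 ∣ 144`, `9 ∥ 144`:
inside BOTH crux domains)**: `|c| = 1 ∧ 2 ∤ c ∧ 3 ∤ c` on every lattice-optimal `X₀(144)`-datum of a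
`2`-additive curve isogenous to the `χ₋₄`-twist of a `2`-additive carrier of a lattice-optimal `X₀(36)`- or
`X₀(72)`-datum — C2 AND C3 on these classes, FACT-FREE. -/
theorem shapes_oneFortyFour_of_root_thirtySix_or_seventyTwo
    {M : ℕ} [NeZero M] (hM : M = 36 ∨ M = 72)
    (A : WeierstrassCurve ℚ) [A.IsElliptic] [A.IsGloballyMinimal] (D : ModularParametrizationData A M)
    (hopt : ∀ z ∈ D.L.lattice, ∃ w ∈ periodLattice D.f, z = D.c * w)
    (haddA : ¬ A.HasGoodReductionAtPrime 2 ∧ ¬ A.HasMultiplicativeReductionAtPrime 2)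
    (W' : WeierstrassCurve ℚ) [W'.IsElliptic] [W'.IsGloballyMinimal] [NeZero (144 : ℕ)]
    (D' : ModularParametrizationData W' 144)
    (htw : IsIsogenous W' (A.quadraticTwist ((-1 : ℤ) : ℚ)))
    (hadd' : ¬ W'.HasGoodReductionAtPrime 2 ∧ ¬ W'.HasMultiplicativeReductionAtPrime 2)
    (hopt' : ∀ z ∈ D'.L.lattice, ∃ w ∈ periodLattice D'.f, z = D'.c * w) :
    |D'.maninConstant| = 1 ∧ ¬ (2 : ℤ) ∣ D'.maninConstant ∧ ¬ (3 : ℤ) ∣ D'.maninConstant := by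
  rcases hM with rfl | rfl
  · exact shapes_of_negOneTwistAdditiveLevelManinOne negOneTwistAdditive_families.2.2.2.1 A D hopt haddA W'
      144 D' (by norm_num) (by norm_num) htw hadd' hopt'
  · exact shapes_of_negOneTwistAdditiveLevelManinOne negOneTwistAdditive_families.2.2.2.2.2.2.2.2.2.2 A D hopt
      haddA W' 144 D' (by norm_num) (by norm_num) htw hadd' hopt'

end Summit.BirchSwinnertonDyer.BirchSwinnertonDyer.Theorems.ManinLocalTwoThree.AdditiveTwistFamilies

end
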